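import Summits.AtomisticToContinuum.Crystallization.Theorems.PerronTransitivityUniformBindingRigidityCohesionK

/-!
# Cohesion of uniformly bound Lennard-Jones configurations, XIII: the sharp sixth-power tail

Helper file (`--supports stmt-AtomisticToContinuum-15099`) of the registered stub
`stub_localHalfSpaceCert` (= `(LOCAL)`) of the line `registered` of the crux
`Summit.AtomisticToContinuum.Crystallization.Theses.PerronTransitivity.UniformBindingRigidity`
(item stmt-AtomisticToContinuum-15099).  Notation: `g_δ(t) = (2t/δ + 1)³` (the packing count of a
`δ`-separated set in a ball of radius `t`, tree `ncard_ball_le`), and the SHARP TAIL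

  `T(δ, R) = 16/(δ³R³) + 18/(δ²R⁴) + 36/(5δR⁵) + 1/R⁶ = ∫_R^∞ 6 g_δ(s) s⁻⁷ ds`.

The far tails of parts II/IX use the tree's dyadic constant `1024/(δ³R³)` (`R ≥ δ`); here it is
replaced by `T(δ, R) ≤ (211/5)/(δ³R³)` for `R ≥ δ` (a factor `> 24`; the leading coefficient `16`
is `2.7×` the continuum value `4π√2/3 ≈ 5.92`), valid moreover for every `R > 0` and every centre:

* §23 the LAYER-CAKE INEQUALITIES `g_δ(a)(a⁻⁶ − b⁻⁶) ≤ T(δ, a) − T(δ, b)` (`a, b > 0`; three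
  sums of squares) and `g_δ(a) a⁻⁶ ≤ T(δ, a)`, and the closed form `T(δ, R) ≤ (211/5)/(δ³R³)`;
* §24 the DISCRETE LAYER-CAKE (Abel) SUMMATION `sum_inv_pow_six_le_sharp_aux`: if finitely many
  points at distance `≥ R` from `p` satisfy `m + #{q' : d(q') ≤ d(q)} ≤ g_δ(d(q))` at each of
  them (`d = dist · p`), then `m R⁻⁶ + Σ d(q)⁻⁶ ≤ T(δ, R)` (induction on the number of points,
  peeling a nearest one); whence for a `δ`-separated `Y`, any centre `p`, any `R > 0` and any
  `B ⊆ {q ∈ Y : dist q p ≥ R}`: `Σ'_{q ∈ B} (dist q p)⁻⁶ ≤ T(δ, R)`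
  (`summable_and_tsum_inv_pow_six_far_le_sharp`, registered as `stub_local_sharpSixthTail`).

Part XIV turns this into the sharp Lennard-Jones tail, truncation and finite-certificate reduction.
All `[folklore]`.
-/

noncomputable section

namespace Summit.AtomisticToContinuum.Crystallization.Theorems.PerronTransitivityUniformBindingRigidity

open scoped BigOperators Topology
open Filter Set Metric
open Literature.MathematicalPhysics.StatisticalMechanics
open Summit.AtomisticToContinuum.Crystallization.Theorems.ChargedEnergyGapNegative (E3)
open Summit.AtomisticToContinuum.Crystallization.Theorems.HullBulkOptimal
  (abs_lennardJones_le tsum_finite_eq_sum ncard_ball_le)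

/-! ## §23 The layer-cake inequalities -/

section LayerCake

/-- `a³(a⁻⁶ − b⁻⁶) ≤ 2(a⁻³ − b⁻³)` for `a, b > 0`: the difference is `a³(a⁻³ − b⁻³)²`
(`= ∫_a^b 6(s³ − a³)s⁻⁷ ds` up to sign conventions). [folklore] -/
theorem cube_mul_inv_pow_six_sub_le {a b : ℝ} (ha : 0 < a) (hb : 0 < b) :
    a ^ 3 * (a⁻¹ ^ 6 - b⁻¹ ^ 6) ≤ 2 * (1 / a ^ 3 - 1 / b ^ 3) := by
  rw [← sub_nonneg]
  have key : 2 * (1 / a ^ 3 - 1 / b ^ 3) - a ^ 3 * (a⁻¹ ^ 6 - b⁻¹ ^ 6) =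
      a ^ 3 * (1 / a ^ 3 - 1 / b ^ 3) ^ 2 := by
    field_simp
    ring
  rw [key]
  positivity

/-- `a²(a⁻⁶ − b⁻⁶) ≤ (3/2)(a⁻⁴ − b⁻⁴)` for `a, b > 0`: the difference is
`(b² − a²)²(b² + 2a²)/(2a⁴b⁶)`. [folklore] -/
theorem sq_mul_inv_pow_six_sub_le {a b : ℝ} (ha : 0 < a) (hb : 0 < b) :
    a ^ 2 * (a⁻¹ ^ 6 - b⁻¹ ^ 6) ≤ 3 / 2 * (1 / a ^ 4 - 1 / b ^ 4) := by
  rw [← sub_nonneg]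
  have key : 3 / 2 * (1 / a ^ 4 - 1 / b ^ 4) - a ^ 2 * (a⁻¹ ^ 6 - b⁻¹ ^ 6) =
      (b ^ 2 - a ^ 2) ^ 2 * (b ^ 2 + 2 * a ^ 2) / (2 * a ^ 4 * b ^ 6) := by
    field_simp
    ring
  rw [key]
  positivity

/-- `a(a⁻⁶ − b⁻⁶) ≤ (6/5)(a⁻⁵ − b⁻⁵)` for `a, b > 0`: the difference is
`(b − a)²(b⁴ + 2ab³ + 3a²b² + 4a³b + 5a⁴)/(5a⁵b⁶)`. [folklore] -/
theorem mul_inv_pow_six_sub_le {a b : ℝ} (ha : 0 < a) (hb : 0 < b) :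
    a * (a⁻¹ ^ 6 - b⁻¹ ^ 6) ≤ 6 / 5 * (1 / a ^ 5 - 1 / b ^ 5) := by
  rw [← sub_nonneg]
  have key : 6 / 5 * (1 / a ^ 5 - 1 / b ^ 5) - a * (a⁻¹ ^ 6 - b⁻¹ ^ 6) =
      (b - a) ^ 2 * (b ^ 4 + 2 * a * b ^ 3 + 3 * a ^ 2 * b ^ 2 + 4 * a ^ 3 * b + 5 * a ^ 4) /
        (5 * a ^ 5 * b ^ 6) := by
    field_simp
    ring
  rw [key]
  positivity

/-- **Layer-cake inequality.** For `δ, a, b > 0`: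
`g_δ(a)(a⁻⁶ − b⁻⁶) ≤ T(δ, a) − T(δ, b)`, `g_δ(a) = (2a/δ + 1)³`,
`T(δ, t) = 16/(δ³t³) + 18/(δ²t⁴) + 36/(5δt⁵) + 1/t⁶` (expand `g_δ(a) = 8a³/δ³ + 12a²/δ² + 6a/δ + 1`
and apply the three previous inequalities; this is `g_δ(a)∫_a^b 6s⁻⁷ ds ≤ ∫_a^b 6 g_δ(s) s⁻⁷ ds`
for `a ≤ b`, and it persists for `b < a`). [folklore] -/
theorem packing_mul_inv_pow_six_sub_le {δ a b : ℝ} (hδ : 0 < δ) (ha : 0 < a) (hb : 0 < b) :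
    (2 * a / δ + 1) ^ 3 * (a⁻¹ ^ 6 - b⁻¹ ^ 6) ≤
      (16 / (δ ^ 3 * a ^ 3) + 18 / (δ ^ 2 * a ^ 4) + 36 / (5 * δ * a ^ 5) + 1 / a ^ 6) -
        (16 / (δ ^ 3 * b ^ 3) + 18 / (δ ^ 2 * b ^ 4) + 36 / (5 * δ * b ^ 5) + 1 / b ^ 6) := by
  have h3 := mul_le_mul_of_nonneg_left (cube_mul_inv_pow_six_sub_le ha hb)
    (by positivity : (0 : ℝ) ≤ 8 / δ ^ 3)
  have h2 := mul_le_mul_of_nonneg_left (sq_mul_inv_pow_six_sub_le ha hb)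
    (by positivity : (0 : ℝ) ≤ 12 / δ ^ 2)
  have h1 := mul_le_mul_of_nonneg_left (mul_inv_pow_six_sub_le ha hb)
    (by positivity : (0 : ℝ) ≤ 6 / δ)
  have e1 : (2 * a / δ + 1) ^ 3 * (a⁻¹ ^ 6 - b⁻¹ ^ 6) =
      8 / δ ^ 3 * (a ^ 3 * (a⁻¹ ^ 6 - b⁻¹ ^ 6)) + 12 / δ ^ 2 * (a ^ 2 * (a⁻¹ ^ 6 - b⁻¹ ^ 6)) +
        6 / δ * (a * (a⁻¹ ^ 6 - b⁻¹ ^ 6)) + (a⁻¹ ^ 6 - b⁻¹ ^ 6) := by ring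
  have e2 : (16 / (δ ^ 3 * a ^ 3) + 18 / (δ ^ 2 * a ^ 4) + 36 / (5 * δ * a ^ 5) + 1 / a ^ 6) -
        (16 / (δ ^ 3 * b ^ 3) + 18 / (δ ^ 2 * b ^ 4) + 36 / (5 * δ * b ^ 5) + 1 / b ^ 6) =
      8 / δ ^ 3 * (2 * (1 / a ^ 3 - 1 / b ^ 3)) + 12 / δ ^ 2 * (3 / 2 * (1 / a ^ 4 - 1 / b ^ 4)) +
        6 / δ * (6 / 5 * (1 / a ^ 5 - 1 / b ^ 5)) + (a⁻¹ ^ 6 - b⁻¹ ^ 6) := by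
    field_simp
    ring
  rw [e1, e2]
  linarith

/-- **Layer-cake inequality at infinity.** `g_δ(a) a⁻⁶ ≤ T(δ, a)` for `δ, a > 0` (the difference is
`8/(δ³a³) + 6/(δ²a⁴) + 6/(5δa⁵)`). [folklore] -/
theorem packing_mul_inv_pow_six_le {δ a : ℝ} (hδ : 0 < δ) (ha : 0 < a) :
    (2 * a / δ + 1) ^ 3 * a⁻¹ ^ 6 ≤
      16 / (δ ^ 3 * a ^ 3) + 18 / (δ ^ 2 * a ^ 4) + 36 / (5 * δ * a ^ 5) + 1 / a ^ 6 := by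
  rw [← sub_nonneg]
  have key : 16 / (δ ^ 3 * a ^ 3) + 18 / (δ ^ 2 * a ^ 4) + 36 / (5 * δ * a ^ 5) + 1 / a ^ 6 -
      (2 * a / δ + 1) ^ 3 * a⁻¹ ^ 6 =
        8 / (δ ^ 3 * a ^ 3) + 6 / (δ ^ 2 * a ^ 4) + 6 / (5 * δ * a ^ 5) := by
    field_simp
    ring
  rw [key]
  positivity

/-- **Closed form of the sharp tail.** `T(δ, R) ≤ (211/5)/(δ³R³)` for `0 < δ ≤ R`
(`16 + 18 + 36/5 + 1 = 211/5`, each lower-order term losing powers of `δ/R ≤ 1`). [folklore] -/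
theorem sharpTail_le_closed {δ R : ℝ} (hδ : 0 < δ) (hR : δ ≤ R) :
    16 / (δ ^ 3 * R ^ 3) + 18 / (δ ^ 2 * R ^ 4) + 36 / (5 * δ * R ^ 5) + 1 / R ^ 6 ≤
      211 / 5 / (δ ^ 3 * R ^ 3) := by
  have hR0 : 0 < R := hδ.trans_le hR
  have h1 : 18 / (δ ^ 2 * R ^ 4) ≤ 18 / (δ ^ 3 * R ^ 3) := by
    rw [div_le_div_iff_of_pos_left (by norm_num) (by positivity) (by positivity)]
    calc δ ^ 3 * R ^ 3 = δ ^ 2 * R ^ 3 * δ := by ring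
      _ ≤ δ ^ 2 * R ^ 3 * R := by gcongr
      _ = δ ^ 2 * R ^ 4 := by ring
  have h2 : 36 / (5 * δ * R ^ 5) ≤ 36 / (5 * δ ^ 3 * R ^ 3) := by
    rw [div_le_div_iff_of_pos_left (by norm_num) (by positivity) (by positivity)]
    calc 5 * δ ^ 3 * R ^ 3 = 5 * δ * R ^ 3 * (δ * δ) := by ring
      _ ≤ 5 * δ * R ^ 3 * (R * R) := by gcongr
      _ = 5 * δ * R ^ 5 := by ring
  have h3 : 1 / R ^ 6 ≤ 1 / (δ ^ 3 * R ^ 3) := by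
    rw [div_le_div_iff_of_pos_left (by norm_num) (by positivity) (by positivity)]
    calc δ ^ 3 * R ^ 3 ≤ R ^ 3 * R ^ 3 := by gcongr
      _ = R ^ 6 := by ring
  have e : (211 / 5 : ℝ) / (δ ^ 3 * R ^ 3) = 16 / (δ ^ 3 * R ^ 3) + 18 / (δ ^ 3 * R ^ 3) +
      36 / (5 * δ ^ 3 * R ^ 3) + 1 / (δ ^ 3 * R ^ 3) := by
    field_simp
    ring
  rw [e]
  linarith

end LayerCake

/-! ## §24 Discrete layer-cake summation and the sharp sixth-power tail -/

section Tail

/-- **Discrete layer-cake summation.** In a metric space, let `s` be a finite set of `n` points at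
distance `≥ R > 0` from `p`, and `m` a natural number with `m ≤ g_δ(R)` and
`m + #{q' ∈ s : d(q') ≤ d(q)} ≤ g_δ(d(q))` for every `q ∈ s` (`d = dist · p`).  Then
`m R⁻⁶ + Σ_{q ∈ s} d(q)⁻⁶ ≤ T(δ, R)`.  Induction on `n`, peeling a nearest point `q₁`
(`d₁ = d(q₁) ≥ R`): the rest satisfies the hypotheses with `(m + 1, d₁)`, so
`m R⁻⁶ + d₁⁻⁶ + Σ_{rest} ≤ m(R⁻⁶ − d₁⁻⁶) + T(δ, d₁) ≤ g_δ(R)(R⁻⁶ − d₁⁻⁶) + T(δ, d₁) ≤ T(δ, R)` by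
the layer-cake inequality. [folklore] -/
theorem sum_inv_pow_six_le_sharp_aux {α : Type*} [MetricSpace α] {δ : ℝ} (hδ : 0 < δ) (p : α) :
    ∀ (n : ℕ) (s : Finset α) (m : ℕ) (R : ℝ), s.card = n → 0 < R →
      (m : ℝ) ≤ (2 * R / δ + 1) ^ 3 →
      (∀ q ∈ s, R ≤ dist q p) →
      (∀ q ∈ s, (m : ℝ) + ((s.filter fun q' => dist q' p ≤ dist q p).card : ℝ) ≤
        (2 * dist q p / δ + 1) ^ 3) →
      (m : ℝ) * R⁻¹ ^ 6 + ∑ q ∈ s, (dist q p)⁻¹ ^ 6 ≤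
        16 / (δ ^ 3 * R ^ 3) + 18 / (δ ^ 2 * R ^ 4) + 36 / (5 * δ * R ^ 5) + 1 / R ^ 6 := by
  classical
  intro n
  induction n with
  | zero =>
    intro s m R hs hR hm _ _
    rw [Finset.card_eq_zero.1 hs, Finset.sum_empty, add_zero]
    calc (m : ℝ) * R⁻¹ ^ 6 ≤ (2 * R / δ + 1) ^ 3 * R⁻¹ ^ 6 :=
          mul_le_mul_of_nonneg_right hm (by positivity)
      _ ≤ _ := packing_mul_inv_pow_six_le hδ hR
  | succ n ih =>
    intro s m R hs hR hm hfar hcount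
    have hne : s.Nonempty := by rw [← Finset.card_pos, hs]; exact Nat.succ_pos n
    obtain ⟨q₁, hq₁, hmin⟩ := s.exists_min_image (fun q => dist q p) hne
    have hRd : R ≤ dist q₁ p := hfar q₁ hq₁
    have hd0 : 0 < dist q₁ p := hR.trans_le hRd
    -- the shifted count at the nearest point
    have hq₁f : q₁ ∈ s.filter (fun q' => dist q' p ≤ dist q₁ p) :=
      Finset.mem_filter.2 ⟨hq₁, le_rfl⟩
    have hcard₁ : (1 : ℝ) ≤ ((s.filter fun q' => dist q' p ≤ dist q₁ p).card : ℝ) := by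
      exact_mod_cast Finset.card_pos.2 ⟨q₁, hq₁f⟩
    have hm' : ((m + 1 : ℕ) : ℝ) ≤ (2 * dist q₁ p / δ + 1) ^ 3 := by
      have := hcount q₁ hq₁
      push_cast
      linarith
    -- the remaining points
    have hs' : (s.erase q₁).card = n := by
      rw [Finset.card_erase_of_mem hq₁, hs]
      rfl
    have hfar' : ∀ q ∈ s.erase q₁, dist q₁ p ≤ dist q p := fun q hq =>
      hmin q (Finset.mem_of_mem_erase hq)
    have hcount' : ∀ q ∈ s.erase q₁, ((m + 1 : ℕ) : ℝ) +
        (((s.erase q₁).filter fun q' => dist q' p ≤ dist q p).card : ℝ) ≤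
          (2 * dist q p / δ + 1) ^ 3 := by
      intro q hq
      have hqs : q ∈ s := Finset.mem_of_mem_erase hq
      have hq₁mem : q₁ ∈ s.filter (fun q' => dist q' p ≤ dist q p) :=
        Finset.mem_filter.2 ⟨hq₁, hmin q hqs⟩
      have hc : (((s.erase q₁).filter fun q' => dist q' p ≤ dist q p).card : ℝ) + 1 =
          ((s.filter fun q' => dist q' p ≤ dist q p).card : ℝ) := by
        rw [Finset.filter_erase]
        exact_mod_cast Finset.card_erase_add_one hq₁mem
      have := hcount q hqs
      push_cast
      linarith
    have IH := ih (s.erase q₁) (m + 1) (dist q₁ p) hs' hd0 hm' hfar' hcount'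
    have hKI := packing_mul_inv_pow_six_sub_le hδ hR hd0
    have hmono : (dist q₁ p)⁻¹ ^ 6 ≤ R⁻¹ ^ 6 := by
      gcongr
    have h1 : (m : ℝ) * (R⁻¹ ^ 6 - (dist q₁ p)⁻¹ ^ 6) ≤
        (2 * R / δ + 1) ^ 3 * (R⁻¹ ^ 6 - (dist q₁ p)⁻¹ ^ 6) :=
      mul_le_mul_of_nonneg_right hm (sub_nonneg.2 hmono)
    rw [← Finset.add_sum_erase s _ hq₁]
    push_cast at IH
    linarith

variable {Y : Set E3} {δ : ℝ}

/-- **Sharp sixth-power sum over finitely many far points of a separated set.** For a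
`δ`-separated `Y`, any centre `p`, `R > 0` and a finite set `s` of points of `Y` at distance `≥ R`
from `p`: `Σ_{q ∈ s} (dist q p)⁻⁶ ≤ T(δ, R)` (the counting hypothesis of the layer-cake summation
with `m = 0` is the tree's packing count `ncard_ball_le`). [folklore] -/
theorem sum_inv_pow_six_le_sharp (hδ : 0 < δ) (hsep : ∀ a ∈ Y, ∀ b ∈ Y, a ≠ b → δ ≤ dist a b)
    (p : E3) {R : ℝ} (hR : 0 < R) (s : Finset E3) (hs : ∀ q ∈ s, q ∈ Y ∧ R ≤ dist q p) :
    ∑ q ∈ s, (dist q p)⁻¹ ^ 6 ≤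
      16 / (δ ^ 3 * R ^ 3) + 18 / (δ ^ 2 * R ^ 4) + 36 / (5 * δ * R ^ 5) + 1 / R ^ 6 := by
  have hcount : ∀ q ∈ s, ((0 : ℕ) : ℝ) + ((s.filter fun q' => dist q' p ≤ dist q p).card : ℝ) ≤
      (2 * dist q p / δ + 1) ^ 3 := by
    intro q hq
    have hfin := finite_sep_ball hδ hsep p (dist q p)
    have hsub : ((s.filter fun q' => dist q' p ≤ dist q p) : Set E3) ⊆
        {y : E3 | y ∈ Y ∧ dist y p ≤ dist q p} := by
      intro y hy
      rw [Finset.coe_filter] at hy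
      exact ⟨(hs y hy.1).1, hy.2⟩
    have h1 : ((s.filter fun q' => dist q' p ≤ dist q p).card : ℝ) ≤
        (({y : E3 | y ∈ Y ∧ dist y p ≤ dist q p} : Set E3).ncard : ℝ) := by
      exact_mod_cast (Set.ncard_coe_finset _).symm.le.trans (Set.ncard_le_ncard hsub hfin)
    have h2 := ncard_ball_le hδ hsep p (dist_nonneg : 0 ≤ dist q p)
    push_cast
    linarith
  have h := sum_inv_pow_six_le_sharp_aux hδ p s.card s 0 R rfl hR
    (by rw [Nat.cast_zero]; positivity) (fun q hq => (hs q hq).2) hcount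
  simpa using h

/-- **Sharp far tail of the sixth-power sum.** For a `δ`-separated `Y`, any centre `p`, `R > 0`
and `B ⊆ {q ∈ Y : dist q p ≥ R}`: the family `(dist q p)⁻⁶` is summable on `B` with sum
`≤ T(δ, R) = 16/(δ³R³) + 18/(δ²R⁴) + 36/(5δR⁵) + 1/R⁶` (all finite partial sums are, by
`sum_inv_pow_six_le_sharp`).  Compare the tree's `1024/(δ³R³)` (`tsum_inv_pow_le_of_separated`,
`R ≥ δ`). [folklore] -/
theorem summable_and_tsum_inv_pow_six_far_le_sharp (hδ : 0 < δ)
    (hsep : ∀ a ∈ Y, ∀ b ∈ Y, a ≠ b → δ ≤ dist a b) (p : E3) {R : ℝ} (hR : 0 < R) {B : Set E3}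
    (hB : B ⊆ {q : E3 | q ∈ Y ∧ R ≤ dist q p}) :
    Summable (fun q : B => (dist (q : E3) p)⁻¹ ^ 6) ∧
      ∑' q : B, (dist (q : E3) p)⁻¹ ^ 6 ≤
        16 / (δ ^ 3 * R ^ 3) + 18 / (δ ^ 2 * R ^ 4) + 36 / (5 * δ * R ^ 5) + 1 / R ^ 6 := by
  classical
  have key : ∀ u : Finset B, ∑ q ∈ u, (dist (q : E3) p)⁻¹ ^ 6 ≤
      16 / (δ ^ 3 * R ^ 3) + 18 / (δ ^ 2 * R ^ 4) + 36 / (5 * δ * R ^ 5) + 1 / R ^ 6 := by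
    intro u
    have h := sum_inv_pow_six_le_sharp hδ hsep p hR (u.image Subtype.val) fun q hq => by
      obtain ⟨q', -, rfl⟩ := Finset.mem_image.1 hq
      exact hB q'.2
    rwa [Finset.sum_image fun a _ b _ h => Subtype.ext h] at h
  have hsum : Summable (fun q : B => (dist (q : E3) p)⁻¹ ^ 6) :=
    summable_of_sum_le (fun _ => by positivity) key
  exact ⟨hsum, Real.tsum_le_of_sum_le (fun _ => by positivity) key⟩

end Tail

/-! ## Registered sub-goal of `stub_localHalfSpaceCert`: the sharp sixth-power tail -/

/-- **Sub-goal `stub_local_sharpSixthTail` of the stub `stub_localHalfSpaceCert`** (registered on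
stmt-AtomisticToContinuum-15099): for a `δ`-separated `Y ⊆ ℝ³`, any centre `p`, any `R > 0` and any
`B ⊆ {q ∈ Y : R ≤ dist q p}`, the family `(dist q p)⁻⁶` is summable on `B` with sum
`≤ 16/(δ³R³) + 18/(δ²R⁴) + 36/(5δR⁵) + 1/R⁶` (`summable_and_tsum_inv_pow_six_far_le_sharp` in arrow
form). [folklore] -/
theorem stub_local_sharpSixthTail :
    ∀ (Y : Set (EuclideanSpace ℝ (Fin 3))) (δ : ℝ), 0 < δ →
      (∀ p ∈ Y, ∀ q ∈ Y, p ≠ q → δ ≤ dist p q) →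
      ∀ (p : EuclideanSpace ℝ (Fin 3)) (R : ℝ), 0 < R →
      ∀ B : Set (EuclideanSpace ℝ (Fin 3)), B ⊆ {q | q ∈ Y ∧ R ≤ dist q p} →
        Summable (fun q : B => (dist (q : EuclideanSpace ℝ (Fin 3)) p)⁻¹ ^ 6) ∧
          ∑' q : B, (dist (q : EuclideanSpace ℝ (Fin 3)) p)⁻¹ ^ 6 ≤
            16 / (δ ^ 3 * R ^ 3) + 18 / (δ ^ 2 * R ^ 4) + 36 / (5 * δ * R ^ 5) + 1 / R ^ 6 :=
  fun _ _ hδ hsep p _ hR _ hB => summable_and_tsum_inv_pow_six_far_le_sharp hδ hsep p hR hB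

end Summit.AtomisticToContinuum.Crystallization.Theorems.PerronTransitivityUniformBindingRigidity

end
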